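import Summits.QuantumFields.YangMills.Theorems.SoloBlindOddTorusSlabDecay
import Summits.QuantumFields.YangMills.Theorems.SoloBlindSpeciesSlab
import Summits.QuantumFields.YangMills.Theorems.SoloBlindInfraredFrontier
import HarnessLib

/-!
# IR-1 at fixed coupling is reflected antipodal decay — every species
# (solo-QuantumFields-blind, rung D8, part 12)

`Summit.QuantumFields.YangMills.Theorems.SoloBlindClusteringReflected` (read-only conjunct
`YangMills`).  Part 7 proved, on the time-zero spatial algebra, that torus-uniform clustering
at a FIXED bare coupling `β ≥ 0` (`ClustersUniformlyAt`, rung D3 — the IR-1 predicate) is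
equivalent to antipodal diagonal decay.  This part removes the restriction, exactly as part 11 did
along a scheme.  Write `ΘA := A.timeReflect` and `c_{A,B}(n; S) := latticeConnectedCorr ρ β (2S+1) A B n`.

* `exists_const_abs_latticeConnectedCorr_le` — the SINGLE-TORUS inequality with `S`-free
  constant: for slab species `A, B` there is `K` (depending on the antipodal constants, the sup
  norms, the rate and the slab heights only) such that on every odd torus `2S+1` with
  `S ≥ 2(T_A+T'_A+T_B+T'_B)+2`, the four antipodal bounds
  `c_{ΘA,A}(S), c_{A,ΘA}(S) ≤ C_A e^{-μS}`, `c_{ΘB,B}(S), c_{B,ΘB}(S) ≤ C_B e^{-μS}` give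
  `|c_{A,B}(n; S)| ≤ K e^{-μ n}` for all `n ≤ S` (`β ≥ 0`, `μ ≥ 0`, any compact `G`);
* `clustersUniformlyAt_iff_reflectedAntipodalDecayAt` — at fixed `β ≥ 0`,
  `(∀ A B, ClustersUniformlyAt r β A B) ↔ ∀ A, ReflectedAntipodalDecayAt r β A`;
* `weakCouplingClustering_iff_reflected`, `gappedAtArbitrarilyWeakCoupling_iff_reflected` —
  the two IR-1 predicates of rung D3 in the same form.

Mechanism: parts 8–10 (OS pairing of slab observables is a positive-semidefinite Hankel kernel
along odd separations; endpoint reduction from the indices `2T'+1, S, S+1`; the index `S+1` is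
the other reflection clause at `S` by going round the torus).  No decay is produced.
[folklore: Seiler LNP 159 Ch. 2; Osterwalder–Seiler 1978 §2]
-/

open MeasureTheory Filter Topology
open Literature.MathematicalPhysics.QuantumFieldTheory Literature.MathematicalPhysics.QuantumLattice

noncomputable section

namespace Summit.QuantumFields.YangMills.Theorems.SoloBlind

variable {G : Type} [Group G] [TopologicalSpace G] [IsTopologicalGroup G] [CompactSpace G]
  [MeasurableSpace G] [BorelSpace G]

/-! ### Arithmetic of the constants (as in part 11) -/

/-- Low index: `x ≤ q ≤ (max C 0 + q)(E t)` when `q ≥ 0`, `E t ≥ 1`. -/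
private theorem le_K_low' {C q E t x : ℝ} (hq : 0 ≤ q) (hx : x ≤ q) (hEt : 1 ≤ E * t) :
    x ≤ (max C 0 + q) * E * t := by
  have h0 : 0 ≤ max C 0 + q := add_nonneg (le_max_right _ _) hq
  calc x ≤ (max C 0 + q) * 1 := by linarith [le_max_right C 0]
    _ ≤ (max C 0 + q) * (E * t) := mul_le_mul_of_nonneg_left hEt h0
    _ = (max C 0 + q) * E * t := by ring

/-- Antipode: `x ≤ C p ≤ (max C 0 + q) E p` when `q ≥ 0`, `E ≥ 1`, `p ≥ 0`. -/
private theorem le_K_mid' {C q E p x : ℝ} (hq : 0 ≤ q) (hE : 1 ≤ E) (hp : 0 ≤ p)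
    (hx : x ≤ C * p) : x ≤ (max C 0 + q) * E * p := by
  have h0 : 0 ≤ max C 0 + q := add_nonneg (le_max_right _ _) hq
  calc x ≤ C * p := hx
    _ ≤ (max C 0 + q) * 1 * p := by
        apply mul_le_mul_of_nonneg_right _ hp; linarith [le_max_left C 0]
    _ ≤ (max C 0 + q) * E * p :=
        mul_le_mul_of_nonneg_right (mul_le_mul_of_nonneg_left hE h0) hp

/-- Past the antipode: `x ≤ C p ≤ (max C 0 + q) E (p θ)` when `q ≥ 0`, `E θ ≥ 1`, `p ≥ 0`. -/
private theorem le_K_succ' {C q E p θ x : ℝ} (hq : 0 ≤ q) (hEθ : 1 ≤ E * θ) (hp : 0 ≤ p)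
    (hx : x ≤ C * p) : x ≤ (max C 0 + q) * E * (p * θ) := by
  have h0 : 0 ≤ max C 0 + q := add_nonneg (le_max_right _ _) hq
  calc x ≤ C * p := hx
    _ ≤ (max C 0 + q) * 1 * p := by
        apply mul_le_mul_of_nonneg_right _ hp; linarith [le_max_left C 0]
    _ ≤ (max C 0 + q) * (E * θ) * p :=
        mul_le_mul_of_nonneg_right (mul_le_mul_of_nonneg_left hEθ h0) hp
    _ = (max C 0 + q) * E * (p * θ) := by ring

/-! ### The single-torus inequality for arbitrary species -/

/-- **Single-torus reduction to the reflected antipodal correlators** (`β ≥ 0`, `μ ≥ 0`, every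
compact `G`, continuous `ρ`).  For slab species `A` (`[-T'_A, T_A]`) and `B` (`[-T'_B, T_B]`)
with sup norms `a₀, b₀` and constants `C_A, C_B` there is ONE constant `K` such that on every odd
torus `(2S+1)⁴` with `S ≥ 2(T_A+T'_A+T_B+T'_B)+2`: if the four reflection correlators at the
antipode obey `c_{ΘA,A}(S), c_{A,ΘA}(S) ≤ C_A e^{-μS}` and `c_{ΘB,B}(S), c_{B,ΘB}(S) ≤ C_B e^{-μS}`,
then `|c_{A,B}(n; S)| ≤ K e^{-μ n}` for every `n ≤ S`.  [this unit's; mechanism folklore] -/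
theorem exists_const_abs_latticeConnectedCorr_le {N : ℕ} (ρ : G →* Matrix (Fin N) (Fin N) ℂ)
    (hρ : Continuous ρ) {β : ℝ} (hβ : 0 ≤ β) {A B : YMSpecies G} {TA' TA TB' TB : ℕ}
    (hA : IsSlabSupported TA' TA A) (hB : IsSlabSupported TB' TB B) {a0 b0 : ℝ}
    (ha0 : ∀ U, |A.F U| ≤ a0) (hb0 : ∀ U, |B.F U| ≤ b0) {μ : ℝ} (hμ : 0 ≤ μ) (CA CB : ℝ) :
    ∃ K : ℝ, ∀ S : ℕ, 2 * (TA + TA' + TB + TB') + 2 ≤ S →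
      latticeConnectedCorr ρ β (2 * S + 1) A.timeReflect.F A.F S ≤ CA * Real.exp (-(μ * S)) →
      latticeConnectedCorr ρ β (2 * S + 1) A.F A.timeReflect.F S ≤ CA * Real.exp (-(μ * S)) →
      latticeConnectedCorr ρ β (2 * S + 1) B.timeReflect.F B.F S ≤ CB * Real.exp (-(μ * S)) →
      latticeConnectedCorr ρ β (2 * S + 1) B.F B.timeReflect.F S ≤ CB * Real.exp (-(μ * S)) →
      ∀ n : ℕ, n ≤ S →
        |latticeConnectedCorr ρ β (2 * S + 1) A.F B.F n| ≤ K * Real.exp (-(μ * n)) := by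
  have ha0' : ∀ U, |A.timeReflect.F U| ≤ a0 := fun U => by simpa using ha0 (cfgReflect U)
  have hb0' : ∀ U, |B.timeReflect.F U| ≤ b0 := fun U => by simpa using hb0 (cfgReflect U)
  set KA : ℝ := (max CA 0 + 2 * (a0 * a0)) * Real.exp (μ * (2 * TA + 1 : ℕ)) with hKA
  set KB : ℝ := (max CB 0 + 2 * (b0 * b0)) * Real.exp (μ * (2 * TB' + 1 : ℕ)) with hKB
  have haa : 0 ≤ 2 * (a0 * a0) := mul_nonneg two_pos.le (mul_self_nonneg a0)
  have hbb : 0 ≤ 2 * (b0 * b0) := mul_nonneg two_pos.le (mul_self_nonneg b0)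
  refine ⟨max (Real.sqrt (KA * KB)) (2 * (a0 * b0) * Real.exp (μ * (2 * (TA + TB') + 2 : ℕ))),
    fun S hS hA1 hA2 hB1 hB2 n hn => ?_⟩
  have hS1 : 1 ≤ S := by omega
  -- the ratio `θ = e^{-μ} ∈ (0, 1]`
  set θ : ℝ := Real.exp (-μ) with hθdef
  have hθ : 0 < θ := Real.exp_pos _
  have hθpow : ∀ j : ℕ, Real.exp (-(μ * j)) = θ ^ j := fun j => by
    rw [hθdef, ← Real.exp_nat_mul]; ring_nf
  have hθS : 0 ≤ θ ^ S := pow_nonneg hθ.le _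
  -- `1 ≤ e^{μ N} θ^j` for `j ≤ N`, and `1 ≤ e^{μ N}`
  have hlow : ∀ {j N₁ : ℕ}, j ≤ N₁ → 1 ≤ Real.exp (μ * N₁) * θ ^ j := by
    intro j N₁ hj
    rw [← hθpow, ← Real.exp_add]
    apply Real.one_le_exp
    have : μ * (j : ℝ) ≤ μ * N₁ := mul_le_mul_of_nonneg_left (by exact_mod_cast hj) hμ
    linarith
  have hE1 : ∀ N₁ : ℕ, (1 : ℝ) ≤ Real.exp (μ * N₁) := fun N₁ =>
    Real.one_le_exp (mul_nonneg hμ (Nat.cast_nonneg _))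
  -- the centred torus observables `FA = Â_c∘Θ'` (`[-T_A, T'_A]`-slab), `FB = B̂_c`
  set FA : GaugeConfig 4 (2 * S + 1) G → ℝ := fun U =>
    toTorusObservable (2 * S + 1) A.F U.negReflect -
      wilsonExpectation ρ β (toTorusObservable (2 * S + 1) A.F) with hFA
  set FB : GaugeConfig 4 (2 * S + 1) G → ℝ := fun U =>
    toTorusObservable (2 * S + 1) B.F U -
      wilsonExpectation ρ β (toTorusObservable (2 * S + 1) B.F) with hFB
  have hAm : Measurable FA :=
    ((A.measurable.comp (measurable_torusLift (2 * S + 1))).comp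
      WilsonSiteRP.measurable_negReflect).sub_const _
  have hBm : Measurable FB := (B.measurable.comp (measurable_torusLift (2 * S + 1))).sub_const _
  have hAb : ∃ C : ℝ, ∀ U, |FA U| ≤ C :=
    ⟨a0 + |wilsonExpectation ρ β (toTorusObservable (2 * S + 1) A.F)|, fun U =>
      (abs_sub _ _).trans (by gcongr; rw [toTorusObservable_apply]; exact ha0 _)⟩
  have hBb : ∃ C : ℝ, ∀ U, |FB U| ≤ C :=
    ⟨b0 + |wilsonExpectation ρ β (toTorusObservable (2 * S + 1) B.F)|, fun U =>
      (abs_sub _ _).trans (by gcongr; rw [toTorusObservable_apply]; exact hb0 _)⟩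
  have hAs : DependsOn FA (slabEdges TA TA') :=
    dependsOn_toTorusObservable_negReflect_slab (by omega) (by omega) hS1 A hA _
  have hBs : DependsOn FB (slabEdges TB' TB) :=
    dependsOn_toTorusObservable_slab (by omega) (by omega) B hB _
  -- the three endpoint bounds for `FA`: indices `2T_A + 1`, `S`, `S + 1`
  have hloA : osPairingSeq ρ β FA FA (2 * TA + 1) ≤ KA * θ ^ (2 * TA + 1) := by
    have h := (le_abs_self _).trans (abs_latticeConnectedCorr_le ρ hρ β S A
      A.timeReflect ha0 ha0' (2 * TA + 1))
    rw [← osPairingSeq_centred_negReflect_eq ρ hρ] at h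
    exact le_K_low' haa h (hlow le_rfl)
  have hm0A : osPairingSeq ρ β FA FA S ≤ KA * θ ^ S := by
    have h := hA2
    rw [hθpow, ← osPairingSeq_centred_negReflect_eq ρ hρ] at h
    exact le_K_mid' haa (hE1 _) hθS h
  have hm1A : osPairingSeq ρ β FA FA (S + 1) ≤ KA * θ ^ (S + 1) := by
    have h := hA1
    rw [hθpow, ← osPairingSeq_centred_negReflect_succ_eq ρ hρ] at h
    have h1 := hlow (N₁ := 2 * TA + 1) (j := 1) (by omega)
    rw [pow_one] at h1
    rw [pow_succ]
    exact le_K_succ' haa h1 hθS h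
  -- the three endpoint bounds for `FB`: indices `2T'_B + 1`, `S`, `S + 1`
  have hloB : osPairingSeq ρ β FB FB (2 * TB' + 1) ≤ KB * θ ^ (2 * TB' + 1) := by
    have h := (le_abs_self _).trans (abs_latticeConnectedCorr_le ρ hρ β S
      B.timeReflect B hb0' hb0 (2 * TB' + 1))
    rw [← osPairingSeq_centred_eq ρ hρ] at h
    exact le_K_low' hbb h (hlow le_rfl)
  have hm0B : osPairingSeq ρ β FB FB S ≤ KB * θ ^ S := by
    have h := hB1
    rw [hθpow, ← osPairingSeq_centred_eq ρ hρ] at h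
    exact le_K_mid' hbb (hE1 _) hθS h
  have hm1B : osPairingSeq ρ β FB FB (S + 1) ≤ KB * θ ^ (S + 1) := by
    have h := hB2
    rw [hθpow, ← osPairingSeq_centred_succ_eq ρ hρ] at h
    have h1 := hlow (N₁ := 2 * TB' + 1) (j := 1) (by omega)
    rw [pow_one] at h1
    rw [pow_succ]
    exact le_K_succ' hbb h1 hθS h
  -- all odd-index diagonal bounds (part 9)
  have hoddA : ∀ j, Odd j → 2 * TA + 1 ≤ j → j ≤ S + 1 →
      osPairingSeq ρ β FA FA j ≤ KA * θ ^ j := fun j hj h1 h2 =>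
    osPairingSeq_odd_le_of_endpoints ρ rfl hρ hβ hAm hAb hAs (by omega) (by omega) hθ hloA
      hm0A hm1A hj h1 h2
  have hoddB : ∀ j, Odd j → 2 * TB' + 1 ≤ j → j ≤ S + 1 →
      osPairingSeq ρ β FB FB j ≤ KB * θ ^ j := fun j hj h1 h2 =>
    osPairingSeq_odd_le_of_endpoints ρ rfl hρ hβ hBm hBb hBs (by omega) (by omega) hθ hloB
      hm0B hm1B hj h1 h2
  -- conclude: OS Schwarz for `n ≥ 2(T_A + T'_B) + 2`, the trivial bound below
  rw [hθpow]
  have hθn : 0 ≤ θ ^ n := pow_nonneg hθ.le _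
  by_cases hnA : 2 * (TA + TB') + 2 ≤ n
  · have hmix := osPairingSeq_mixed_abs_le ρ rfl hρ hβ hAm hAb hAs hBm hBb hBs (by omega)
      (by omega) hθ hoddA hoddB (n := n) (by omega) (by omega) hn
    rw [latticeConnectedCorr_eq_osPairingSeq ρ hρ]
    exact hmix.trans (mul_le_mul_of_nonneg_right (le_max_left _ _) hθn)
  · push Not at hnA
    have hsmall := abs_latticeConnectedCorr_le ρ hρ β S A B ha0 hb0 n
    have hab : 0 ≤ 2 * (a0 * b0) := (abs_nonneg _).trans hsmall
    have h1 := hlow (N₁ := 2 * (TA + TB') + 2) (j := n) (by omega)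
    calc |latticeConnectedCorr ρ β (2 * S + 1) A.F B.F n|
        ≤ 2 * (a0 * b0) := hsmall
      _ ≤ 2 * (a0 * b0) * (Real.exp (μ * (2 * (TA + TB') + 2 : ℕ)) * θ ^ n) :=
          le_mul_of_one_le_right hab h1
      _ = 2 * (a0 * b0) * Real.exp (μ * (2 * (TA + TB') + 2 : ℕ)) * θ ^ n := by ring
      _ ≤ max (Real.sqrt (KA * KB)) (2 * (a0 * b0) * Real.exp (μ * (2 * (TA + TB') + 2 : ℕ))) *
            θ ^ n :=
          mul_le_mul_of_nonneg_right (le_max_right _ _) hθn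

/-! ### Fixed coupling: the IR-1 predicates of rung D3 -/

/-- **Reflected antipodal decay at bare coupling `β`** of the species `A`: for some `C`, some
lattice rate `m > 0` and threshold `S₀`, both reflection correlators at the antipode obey
`c_{ΘA,A}(S; S), c_{A,ΘA}(S; S) ≤ C e^{-mS}` on every odd torus of period `2S+1 ≥ 2S₀+1`. -/
def ReflectedAntipodalDecayAt (r : LatticeRep G) (β : ℝ) (A : YMSpecies G) : Prop :=
  ∃ C m : ℝ, 0 < m ∧ ∃ S₀ : ℕ, ∀ S : ℕ, S₀ ≤ S →
    latticeConnectedCorr r.ρ β (2 * S + 1) A.timeReflect.F A.F S ≤ C * Real.exp (-(m * S)) ∧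
      latticeConnectedCorr r.ρ β (2 * S + 1) A.F A.timeReflect.F S ≤ C * Real.exp (-(m * S))

/-- Weakening the rate and enlarging the constant of an antipodal bound. -/
private theorem antipodal_weaken {c C C' m m' : ℝ} {S : ℕ} (hC : C ≤ C') (hC' : 0 ≤ C')
    (hm : m' ≤ m) (h : c ≤ C * Real.exp (-(m * S))) : c ≤ C' * Real.exp (-(m' * S)) := by
  have hS : (0 : ℝ) ≤ S := Nat.cast_nonneg S
  calc c ≤ C * Real.exp (-(m * S)) := h
    _ ≤ C' * Real.exp (-(m * S)) := mul_le_mul_of_nonneg_right hC (Real.exp_pos _).le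
    _ ≤ C' * Real.exp (-(m' * S)) :=
        mul_le_mul_of_nonneg_left (Real.exp_le_exp.mpr (by nlinarith)) hC'

/-- Torus-uniform clustering of the two reflected pairs `(ΘA, A)`, `(A, ΘA)` contains reflected
antipodal decay of `A` (`n = S`, common rate the smaller one). -/
theorem reflectedAntipodalDecayAt_of_clustersUniformlyAt {r : LatticeRep G} {β : ℝ}
    {A : YMSpecies G} (h₁ : ClustersUniformlyAt r β A.timeReflect A)
    (h₂ : ClustersUniformlyAt r β A A.timeReflect) : ReflectedAntipodalDecayAt r β A := by
  obtain ⟨C₁, m₁, hm₁, S₁, hC₁⟩ := h₁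
  obtain ⟨C₂, m₂, hm₂, S₂, hC₂⟩ := h₂
  refine ⟨max (max C₁ C₂) 0, min m₁ m₂, lt_min hm₁ hm₂, max S₁ S₂, fun S hS => ⟨?_, ?_⟩⟩
  · exact antipodal_weaken ((le_max_left _ _).trans (le_max_left _ _)) (le_max_right _ _)
      (min_le_left _ _) ((le_abs_self _).trans (hC₁ S ((le_max_left _ _).trans hS) S le_rfl))
  · exact antipodal_weaken ((le_max_right _ _).trans (le_max_left _ _)) (le_max_right _ _)
      (min_le_right _ _) ((le_abs_self _).trans (hC₂ S ((le_max_right _ _).trans hS) S le_rfl))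

/-- **IR-1 for an arbitrary pair from reflected antipodal decay** (fixed `β ≥ 0`, every compact
`G`): reflected antipodal decay of `A` and of `B` implies torus-uniform exponential clustering of
`(A, B)` at the smaller of the two rates. [this unit's] -/
theorem clustersUniformlyAt_of_reflectedAntipodalDecayAt (r : LatticeRep G) {β : ℝ} (hβ : 0 ≤ β)
    (A B : YMSpecies G) (hdA : ReflectedAntipodalDecayAt r β A)
    (hdB : ReflectedAntipodalDecayAt r β B) : ClustersUniformlyAt r β A B := by
  obtain ⟨TA', TA, hA⟩ := exists_isSlabSupported A
  obtain ⟨TB', TB, hB⟩ := exists_isSlabSupported B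
  obtain ⟨CA, mA, hmA, SA, hCA⟩ := hdA
  obtain ⟨CB, mB, hmB, SB, hCB⟩ := hdB
  obtain ⟨a0, ha0⟩ := A.bounded
  obtain ⟨b0, hb0⟩ := B.bounded
  set μ : ℝ := min mA mB with hμdef
  have hμ : 0 < μ := lt_min hmA hmB
  obtain ⟨K, hK⟩ := exists_const_abs_latticeConnectedCorr_le r.ρ r.continuous hβ hA hB ha0 hb0
    hμ.le (max CA 0) (max CB 0)
  refine ⟨K, μ, hμ, max (max SA SB) (2 * (TA + TA' + TB + TB') + 2), fun S hS n hn => ?_⟩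
  have hSA : SA ≤ S := le_trans (le_max_left _ _) ((le_max_left _ _).trans hS)
  have hSB : SB ≤ S := le_trans (le_max_right _ _) ((le_max_left _ _).trans hS)
  have hS' : 2 * (TA + TA' + TB + TB') + 2 ≤ S := (le_max_right _ _).trans hS
  have wA := fun {c : ℝ} (h : c ≤ CA * Real.exp (-(mA * S))) =>
    antipodal_weaken (le_max_left CA 0) (le_max_right _ _) (min_le_left mA mB) h
  have wB := fun {c : ℝ} (h : c ≤ CB * Real.exp (-(mB * S))) =>
    antipodal_weaken (le_max_left CB 0) (le_max_right _ _) (min_le_right mA mB) h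
  exact hK S hS' (wA (hCA S hSA).1) (wA (hCA S hSA).2) (wB (hCB S hSB).1) (wB (hCB S hSB).2)
    n hn

/-- **At fixed `β ≥ 0`, torus-uniform clustering of ALL pairs (IR-1 at `β`) is equivalent to
reflected antipodal decay of every single species.** [this unit's] -/
theorem clustersUniformlyAt_iff_reflectedAntipodalDecayAt (r : LatticeRep G) {β : ℝ}
    (hβ : 0 ≤ β) :
    (∀ A B : YMSpecies G, ClustersUniformlyAt r β A B) ↔
      ∀ A : YMSpecies G, ReflectedAntipodalDecayAt r β A :=
  ⟨fun h A => reflectedAntipodalDecayAt_of_clustersUniformlyAt (h A.timeReflect A) (h A _),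
    fun h A B => clustersUniformlyAt_of_reflectedAntipodalDecayAt r hβ A B (h A) (h B)⟩

/-- **`WeakCouplingClustering` (IR-1 along a weak-coupling sequence, rung D3) in reflected
antipodal form**: some `β_k → ∞` along which every species eventually has reflected antipodal
decay. [this unit's] -/
theorem weakCouplingClustering_iff_reflected (r : LatticeRep G) :
    WeakCouplingClustering r ↔
      ∃ β : ℕ → ℝ, Tendsto β atTop atTop ∧
        ∀ A : YMSpecies G, ∀ᶠ k in atTop, ReflectedAntipodalDecayAt r (β k) A := by
  constructor
  · rintro ⟨β, hβ, h⟩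
    refine ⟨β, hβ, fun A => ?_⟩
    filter_upwards [h A.timeReflect A, h A A.timeReflect] with k h₁ h₂
    exact reflectedAntipodalDecayAt_of_clustersUniformlyAt h₁ h₂
  · rintro ⟨β, hβ, h⟩
    refine ⟨β, hβ, fun A B => ?_⟩
    filter_upwards [h A, h B, hβ.eventually_ge_atTop 0] with k hA hB hk
    exact clustersUniformlyAt_of_reflectedAntipodalDecayAt r hk A B hA hB

/-- **`GappedAtArbitrarilyWeakCoupling` (a massive phase at arbitrarily weak coupling, rung D3)
in reflected antipodal form.** [this unit's] -/
theorem gappedAtArbitrarilyWeakCoupling_iff_reflected (r : LatticeRep G) :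
    GappedAtArbitrarilyWeakCoupling r ↔
      ∀ β₁ : ℝ, ∃ β : ℝ, β₁ ≤ β ∧ ∀ A : YMSpecies G, ReflectedAntipodalDecayAt r β A := by
  constructor
  · intro h β₁
    obtain ⟨β, hβ, hcl⟩ := h β₁
    exact ⟨β, hβ, fun A => reflectedAntipodalDecayAt_of_clustersUniformlyAt (hcl _ _) (hcl _ _)⟩
  · intro h β₁
    obtain ⟨β, hβ, hd⟩ := h (max β₁ 0)
    exact ⟨β, (le_max_left _ _).trans hβ, fun A B =>
      clustersUniformlyAt_of_reflectedAntipodalDecayAt r ((le_max_right _ _).trans hβ) A B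
        (hd A) (hd B)⟩

end Summit.QuantumFields.YangMills.Theorems.SoloBlind

end
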